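import Literature.NumberTheory.EllipticCurves.RealPeriod
import Literature.NumberTheory.EllipticCurves.UniformizationProofs
import Literature.NumberTheory.EllipticCurves.UniformizationUniqueProofs
import Literature.NumberTheory.EllipticCurves.RealLatticePeriodDiscrProofs
import Mathlib.MeasureTheory.Group.Integral
import HarnessLib

/-!
# Discharge of `WeierstrassCurve.exists_periodPair_realPeriod_eq`

D-0014 keeps `Literature/` sorry-free by stating cited results as named facts `def X : Prop`.
The fact `WeierstrassCurve.exists_periodPair_realPeriod_eq` of
`Literature.NumberTheory.EllipticCurves.RealPeriod` (Silverman AEC VI.5.1 + C.16: an elliptic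
curve `W/ℝ` has a period lattice `Λ` with `g₂(Λ) = c₄/12`, `g₃(Λ) = c₆/216`, and
`Ω(W) = 2∫_{ψ>0} dx/√ψ = #components · Ω₀(Λ)`) needs the Uniformization Theorem (not proved in
Silverman, not in Mathlib) and the classical analysis of `℘` of a real lattice on the real axis;
both are now proved in the sibling files, and this file assembles them:

* `exists_periodPair_realPeriod_eq_of` : the fact follows from the three named facts
  `PeriodPair.uniformization`, `PeriodPair.uniformization_unique` (Silverman AEC VI.5.1,
  `Literature/…/Uniformization.lean`) and `PeriodPair.IsReal.realPeriod_formula` (Lawden Ch. 6,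
  `Literature/…/RealLatticePeriod.lean`);
* `exists_periodPair_realPeriod_eq_holds` : the discharge, feeding in
  `PeriodPair.uniformization_holds` (`UniformizationProofs.lean`, via Mathlib's level-one
  modular forms), `PeriodPair.uniformization_unique_holds` (`UniformizationUniqueProofs.lean`)
  and `PeriodPair.IsReal.realPeriod_formula_holds` (`RealLatticePeriodDiscrProofs.lean`).

Architecture (the printed proofs: Silverman AEC VI.5.1, C.16; Lawden §§6.11–6.17):
1. `A = c₄/12`, `B = c₆/216` satisfy `A³ − 27B² = (c₄³ − c₆²)/1728 = Δ ≠ 0`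
   (Mathlib `WeierstrassCurve.c_relation`), so VI.5.1 gives `Λ` with `g₂ = A`, `g₃ = B`
   (`twoTorsionPolynomial_toPoly_eval_sub`, via `eval_twoTorsionPolynomial` of `RealPeriod.lean`).
2. `conj Λ` has invariants `conj A = A`, `conj B = B`, so `conj Λ = Λ` by uniqueness: `Λ` is a real
   lattice (`PeriodPair.isReal_of_g₂_g₃_real`).
3. Completing the cube, `ψ(x − b₂/12) = 4x³ − Ax − B =: f(x)` where
   `ψ = 4x³ + b₂x² + 2b₄x + b₆` is the 2-torsion polynomial, so by translation invariance of
   Lebesgue measure `Ω(W) = 2∫_{ψ>0} dx/√ψ = 2∫_{f>0} dx/√f`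
   (`setIntegral_comp_add_right_preimage`).
4. The real-period formula for real lattices gives `2∫_{f>0} dx/√f = n · Ω₀` with `n = 2` iff
   `A³ − 27B² = Δ > 0`, i.e. `n = numRealComponents W`.

## References

* J. H. Silverman, *The Arithmetic of Elliptic Curves*, 2nd ed., Thm. VI.5.1, §C.16.
* D. F. Lawden, *Elliptic Functions and Applications*, §§6.11–6.17.
-/

noncomputable section

open scoped Classical
open MeasureTheory Polynomial Set

namespace WeierstrassCurve

variable (W : WeierstrassCurve ℝ)

/-- Completing the cube in the 2-torsion polynomial (Silverman AEC §III.1, the substitution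
`x ↦ x − b₂/12` leading to `y² = 4x³ − (c₄/12)x − c₆/216`, equivalently
`y² = x³ − 27c₄x − 54c₆`): `ψ(x − b₂/12) = 4x³ − (c₄/12)x − c₆/216`. [folklore] -/
lemma twoTorsionPolynomial_toPoly_eval_sub (x : ℝ) :
    W.twoTorsionPolynomial.toPoly.eval (x - W.b₂ / 12) =
      4 * x ^ 3 - W.c₄ / 12 * x - W.c₆ / 216 := by
  rw [eval_twoTorsionPolynomial]
  simp only [c₄, c₆]
  ring

/-- Translation invariance of a set integral over `ℝ` in the form used below:
`∫_{x | g(x + c) ∈ s} φ(g(x + c)) dx = ∫_{x | g x ∈ s} φ(g x) dx`. [folklore] -/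
lemma setIntegral_comp_add_right_preimage (g : ℝ → ℝ) (hg : Measurable g) (s : Set ℝ)
    (hs : MeasurableSet s) (φ : ℝ → ℝ) (c : ℝ) :
    ∫ x in {x | g (x + c) ∈ s}, φ (g (x + c)) = ∫ x in {x | g x ∈ s}, φ (g x) := by
  have hm : MeasurableSet {x : ℝ | g x ∈ s} := hg hs
  have hm' : MeasurableSet {x : ℝ | g (x + c) ∈ s} := (hg.comp (measurable_add_const c)) hs
  rw [← integral_indicator hm, ← integral_indicator hm']
  have : (fun x ↦ {x : ℝ | g (x + c) ∈ s}.indicator (fun x ↦ φ (g (x + c))) x) =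
      fun x ↦ {x : ℝ | g x ∈ s}.indicator (fun x ↦ φ (g x)) (x + c) := by
    ext x
    simp only [Set.indicator, mem_setOf_eq]
  rw [this]
  exact integral_add_right_eq_self (fun x ↦ {x : ℝ | g x ∈ s}.indicator (fun x ↦ φ (g x)) x) c

/-- **Assembly step.**  The named fact `WeierstrassCurve.exists_periodPair_realPeriod_eq`
(Silverman AEC VI.5.1 and C.16) follows from the Uniformization Theorem (existence and
uniqueness, AEC VI.5.1) and the real-period formula for real lattices (Lawden §§6.11–6.17).
[cite: SilvermanAEC2009, Thm VI.5.1 and C.16] -/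
theorem exists_periodPair_realPeriod_eq_of (hU : PeriodPair.uniformization)
    (hU' : PeriodPair.uniformization_unique) (hR : PeriodPair.IsReal.realPeriod_formula) :
    W.exists_periodPair_realPeriod_eq := by
  intro hE
  -- Step 1: the invariants and the lattice; `(c₄/12)³ − 27(c₆/216)² = (c₄³ − c₆²)/1728 = Δ`
  -- (Silverman AEC III.1; cf. `WeierstrassCurve.c₄_div_cube_sub_eq_Δ` in `ComplexPeriod.lean`)
  have hAB : (W.c₄ / 12) ^ 3 - 27 * (W.c₆ / 216) ^ 2 = W.Δ := by
    rw [show (W.c₄ / 12) ^ 3 - 27 * (W.c₆ / 216) ^ 2 = (W.c₄ ^ 3 - W.c₆ ^ 2) / 1728 by ring,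
      ← W.c_relation]
    ring
  have hΔ : W.Δ ≠ 0 := W.isUnit_Δ.ne_zero
  have hne : ((W.c₄ / 12 : ℝ) : ℂ) ^ 3 - 27 * ((W.c₆ / 216 : ℝ) : ℂ) ^ 2 ≠ 0 := by
    exact_mod_cast hAB ▸ hΔ
  obtain ⟨L, hL₂, hL₃⟩ := hU _ _ hne
  refine ⟨L, hL₂, hL₃, ?_⟩
  -- Step 2: the lattice is real
  have hre₂ : L.g₂.re = W.c₄ / 12 := by rw [hL₂, Complex.ofReal_re]
  have hre₃ : L.g₃.re = W.c₆ / 216 := by rw [hL₃, Complex.ofReal_re]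
  have hreal : L.IsReal :=
    PeriodPair.isReal_of_g₂_g₃_real hU' (by rw [hL₂, Complex.ofReal_im])
      (by rw [hL₃, Complex.ofReal_im])
  -- Step 4: the real-period formula for `Λ`
  have hform := hR hreal (by rw [hre₂, hre₃, hAB]; exact hΔ)
  rw [hre₂, hre₃, hAB] at hform
  -- Step 3: `Ω(W) = 2 ∫_{f > 0} dx/√f` by the translation `x ↦ x - b₂/12`
  set f : ℝ → ℝ := fun x ↦ 4 * x ^ 3 - W.c₄ / 12 * x - W.c₆ / 216 with hf
  have hfm : Measurable f := by fun_prop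
  have hψ : ∀ x, W.twoTorsionPolynomial.toPoly.eval x = f (x + W.b₂ / 12) := by
    intro x
    have := W.twoTorsionPolynomial_toPoly_eval_sub (x + W.b₂ / 12)
    rwa [add_sub_cancel_right] at this
  have hΩ : W.realPeriod = 2 * ∫ x in {x | 0 < f x}, (Real.sqrt (f x))⁻¹ := by
    have hset : W.twoTorsionSet = {x | f (x + W.b₂ / 12) ∈ Ioi 0} := by
      ext x; simp [twoTorsionSet, hψ]
    simp only [realPeriod, hset, hψ]
    rw [setIntegral_comp_add_right_preimage f hfm (Ioi 0) measurableSet_Ioi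
      (fun y ↦ (Real.sqrt y)⁻¹) (W.b₂ / 12)]
    rfl
  rw [hΩ, ← PeriodPair.minRealPeriod_def]
  convert hform using 2
  simp only [numRealComponents]
  split_ifs <;> norm_num

/-- **Discharge** of the named fact `WeierstrassCurve.exists_periodPair_realPeriod_eq`
(Silverman AEC Thm. VI.5.1 with C.16): for an elliptic curve `W/ℝ` there is a period pair `L`
with `g₂(L) = c₄/12`, `g₃(L) = c₆/216` and `Ω(W) = numRealComponents(W) · min {t > 0 | t ∈ Λ_L}`.
[cite: SilvermanAEC2009, Thm VI.5.1 and C.16] -/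
theorem exists_periodPair_realPeriod_eq_holds : W.exists_periodPair_realPeriod_eq :=
  W.exists_periodPair_realPeriod_eq_of PeriodPair.uniformization_holds
    PeriodPair.uniformization_unique_holds PeriodPair.IsReal.realPeriod_formula_holds

end WeierstrassCurve

end
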